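import Literature.MathematicalPhysics.QuantumLattice.GrassmannIntegralGaussianProofs
import Literature.MathematicalPhysics.QuantumLattice.GrassmannIntegralBerezinProofs
import Literature.MathematicalPhysics.QuantumLattice.GrassmannPairCalculus
import HarnessLib

/-!
# Gaussian Berezin integrals in COMPOSITE anticommuting fields (transport of Berezin's theorem)

Berezin's Gaussian formula `∫ dψ̄dψ exp(∑ K_{uv} ψ̄_u ψ_v) = ± det K` (Berezin 1966, Ch. I §3,
Thm 3.1; the tree's `berezin_grassmannExp_quadratic_holds`) concerns the GENERATORS `ψ̄_u, ψ_v` of a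
Grassmann algebra.  In strong-coupling lattice gauge theory one meets the same Gaussian in COMPOSITE
odd fields: for `G = SU(N)`, `N` odd, the baryon products `b̄(u) = ψ̄₁(u)⋯ψ̄_N(u)`,
`b(v) = ψ₁(v)⋯ψ_N(v)` (Montvay–Münster (5.44)) anticommute pairwise and square to zero, and the
baryonic part of the `β = 0` effective weight is `exp(∑_{u,v} K_{uv} b̄(u)b(v))` (Rossi–Wolff;
Fromm–de Forcrand (4)–(6): the baryon loops).  This file proves the TRANSPORT: a family
`(x_i)_{i ∈ S ⊕ S}` of pairwise anticommuting elements of a Grassmann algebra `Λ(J)` defines, by the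
universal property of the exterior algebra, an algebra homomorphism
`φ : Λ[c̄_u, c_u : u ∈ S] → Λ(J)`, `c̄_u ↦ x_{inl u}`, `c_u ↦ x_{inr u}` (`compositeHom`); if every
`x_i` is homogeneous of degree `N ≥ 1` and `P` is homogeneous of the complementary degree, then by
degree counting only the top monomial of `Λ[c̄, c]` survives,

  `∫_J P · φ(ω) = (∫_{S⊕S} ω) · ∫_J P · φ(c̄_{u₁}⋯c̄_{u_k} c_{u₁}⋯c_{u_k})`     (`berezin_mul_compositeHom`),

and hence, with Berezin's theorem on `Λ[c̄, c]`,

  `∫_J P · exp(∑_{u,v} K_{uv} x_{inl u} x_{inr v}) = (-1)^{k(k-1)/2} det K · ∫_J P · (x_{inl u₁}⋯)(x_{inr u₁}⋯)`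

(`berezin_mul_grassmannExp_composite`).  This is the device by which the fermion loops of a
monomer–dimer-type expansion are resummed into a determinant (cf. the "fermion bag" resummations
of Chandrasekharan–Li, PRD 85 (2012) 091502, p. 7: correlation functions of the free staggered
action "`= det G[{x}]`"); here it will serve the baryon loops of `β = 0` `SU(N)`.

## Main statements

* `compositeHom x hx` and `compositeHom_gen`, `compositeHom_quadratic`, `compositeHom_grassmannExp`;
* `compositeHom_grassmannBasis_mem` — `φ(θ_T) ∈ ⋀^{N|T|}` when all `x_i ∈ ⋀^N`;
* **`berezin_mul_compositeHom`** — the transport formula above;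
* **`berezin_mul_grassmannExp_composite`** — the composite Gaussian integral is `± det K` times the
  integral of the top composite monomial;
* `compositeHom_grassmannBasis_univ` — that top monomial is `(∏_u x_{inl u})(∏_u x_{inr u})`
  in increasing order.

Honest framing: pure Grassmann-algebra bookkeeping over `ℂ`; nothing here is specific to a gauge
group, a lattice, or a sign of `det K`.

## References

* F. A. Berezin, *The Method of Second Quantization* (1966), Ch. I §3, Thm 3.1, (3.3)–(3.5). [Berezin1966]
* I. Montvay, G. Münster, *Quantum Fields on a Lattice* (1994), §4.1.3 (4.22), §5.1.4 (5.44). [MontvayMunster1994]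
* M. Fromm, Ph. de Forcrand, arXiv:0811.1931, (4)–(6). [FrommForcrand2008]
* S. Chandrasekharan, A. Li, Phys. Rev. D 85 (2012) 091502 (arXiv:1202.6572), §4 p. 7. [ChandrasekharanLi2012]
-/

noncomputable section

namespace Literature.MathematicalPhysics.QuantumLattice

namespace GrassmannAlgebra

open ExteriorAlgebra Matrix

section CompositeGaussian

variable {J : Type*} [LinearOrder J] [Fintype J]
variable {S : Type*} [LinearOrder S] [Fintype S]

/-! ### Degrees -/

omit [LinearOrder J] [Fintype J] in
/-- Degrees add under multiplication: `⋀^i · ⋀^j ⊆ ⋀^{i+j}`. [cite: Berezin1966, Ch. I §3 (3.3)] -/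
theorem mul_mem_exteriorPower {a b : GrassmannAlgebra ℂ J} {i j : ℕ} (ha : a ∈ ⋀[ℂ]^i (J → ℂ))
    (hb : b ∈ ⋀[ℂ]^j (J → ℂ)) : a * b ∈ ⋀[ℂ]^(i + j) (J → ℂ) := by
  rw [exteriorPower, pow_add]
  exact Submodule.mul_mem_mul ha hb

omit [LinearOrder J] [Fintype J] in
/-- A list product of degree-`d` elements has degree `d · length`. [cite: Berezin1966, Ch. I §3 (3.3)] -/
theorem list_prod_mem_exteriorPower {d : ℕ} :
    ∀ (l : List (GrassmannAlgebra ℂ J)), (∀ a ∈ l, a ∈ ⋀[ℂ]^d (J → ℂ)) → l.prod ∈ ⋀[ℂ]^(d * l.length) (J → ℂ)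
  | [], _ => by
    rw [List.prod_nil, List.length_nil, mul_zero, exteriorPower, pow_zero]
    exact Submodule.mem_one.2 ⟨1, map_one _⟩
  | a :: l, h => by
    rw [List.prod_cons, List.length_cons, Nat.mul_succ, add_comm]
    exact mul_mem_exteriorPower (h a (by simp)) (list_prod_mem_exteriorPower l fun b hb => h b (by simp [hb]))

omit [LinearOrder J] [Fintype J] in
/-- A generator has degree one. [cite: Berezin1966, Ch. I §3 (3.1)] -/
theorem gen_mem_exteriorPower_one [DecidableEq J] (i : J) : (gen ℂ i : GrassmannAlgebra ℂ J) ∈ ⋀[ℂ]^1 (J → ℂ) := by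
  rw [exteriorPower, pow_one]
  exact LinearMap.mem_range_self _ _

/-! ### The homomorphism defined by an anticommuting family -/

variable (x : S ⊕ₗ S → GrassmannAlgebra ℂ J)

omit [LinearOrder J] [Fintype J] [LinearOrder S] in
/-- A linear combination of pairwise anticommuting elements squares to zero. [cite: Berezin1966, Ch. I §3 (3.1)] -/
theorem linearCombination_mul_self (hx : ∀ i j, x i * x j + x j * x i = 0) (w : S ⊕ₗ S → ℂ) :
    Fintype.linearCombination ℂ x w * Fintype.linearCombination ℂ x w = 0 := by
  rw [Fintype.linearCombination_apply]
  set T := (∑ i, w i • x i) * ∑ i, w i • x i with hT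
  have hexp : T = ∑ i, ∑ j, (w i * w j) • (x i * x j) := by
    rw [hT, Finset.sum_mul_sum]
    refine Finset.sum_congr rfl fun i _ => Finset.sum_congr rfl fun j _ => ?_
    rw [smul_mul_smul_comm]
  have h2 : T + T = 0 := by
    conv_lhs => rw [hexp]; arg 2; rw [Finset.sum_comm]
    rw [← Finset.sum_add_distrib]
    refine Finset.sum_eq_zero fun i _ => ?_
    rw [← Finset.sum_add_distrib]
    refine Finset.sum_eq_zero fun j _ => ?_
    rw [mul_comm (w j) (w i), ← smul_add, hx i j, smul_zero]
  have h : T = (2 : ℂ)⁻¹ • (T + T) := by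
    rw [← two_smul ℂ T, smul_smul, inv_mul_cancel₀ two_ne_zero, one_smul]
  rw [h, h2, smul_zero]

/-- **The algebra homomorphism `φ : Λ[c̄_u, c_u] → Λ(J)` defined by a pairwise anticommuting family**
`x_{inl u} = "c̄_u"`, `x_{inr u} = "c_u"` (universal property of the exterior algebra). [cite: Berezin1966, Ch. I §3 (3.1)] -/
def compositeHom (hx : ∀ i j, x i * x j + x j * x i = 0) :
    GrassmannAlgebra ℂ (S ⊕ₗ S) →ₐ[ℂ] GrassmannAlgebra ℂ J :=
  ExteriorAlgebra.lift ℂ ⟨Fintype.linearCombination ℂ x, linearCombination_mul_self x hx⟩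

variable {x}
variable (hx : ∀ i j, x i * x j + x j * x i = 0)

omit [LinearOrder J] [Fintype J] [LinearOrder S] in
/-- `φ(θ_i) = x_i` on generators (for any decidable-equality structure used to write the generator). [cite: Berezin1966, Ch. I §3 (3.1)] -/
theorem compositeHom_gen [inst : DecidableEq (S ⊕ₗ S)] (i : S ⊕ₗ S) : compositeHom x hx (@gen ℂ _ _ inst i) = x i := by
  rw [compositeHom, gen, ExteriorAlgebra.lift_ι_apply]
  rw [Fintype.linearCombination_apply, Finset.sum_eq_single i, Pi.single_eq_same, one_smul]
  · intro j _ hj; rw [Pi.single_eq_of_ne hj, zero_smul]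
  · intro h; exact absurd (Finset.mem_univ i) h

omit [LinearOrder J] [Fintype J] in
/-- `φ(c̄_u) = x_{inl u}`. [cite: Berezin1966, Ch. I §3 (3.1)] -/
theorem compositeHom_psiBar (u : S) : compositeHom x hx (psiBar ℂ u) = x (toLex (Sum.inl u)) :=
  compositeHom_gen hx _

omit [LinearOrder J] [Fintype J] in
/-- `φ(c_u) = x_{inr u}`. [cite: Berezin1966, Ch. I §3 (3.1)] -/
theorem compositeHom_psi (u : S) : compositeHom x hx (psi ℂ u) = x (toLex (Sum.inr u)) :=
  compositeHom_gen hx _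

omit [LinearOrder J] [Fintype J] in
/-- `φ(∑ K_{uv} c̄_u c_v) = ∑ K_{uv} x_{inl u} x_{inr v}`. [cite: Berezin1966, Ch. I §3 Thm 3.1] -/
theorem compositeHom_quadratic (K : Matrix S S ℂ) :
    compositeHom x hx (quadratic ℂ K) = ∑ u, ∑ v, K u v • (x (toLex (Sum.inl u)) * x (toLex (Sum.inr v))) := by
  simp only [quadratic, map_sum, map_smul, map_mul, compositeHom_psiBar, compositeHom_psi]

omit [LinearOrder J] [Fintype J] in
/-- `φ` commutes with the exponential of the (nilpotent) quadratic form. [cite: Berezin1966, Ch. I §3 Thm 3.1] -/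
theorem compositeHom_grassmannExp_quadratic (K : Matrix S S ℂ) :
    compositeHom x hx (grassmannExp (quadratic ℂ K)) = grassmannExp (compositeHom x hx (quadratic ℂ K)) := by
  have hn : IsNilpotent (quadratic ℂ K) := by
    have h := smul_quadratic_pow_eq_zero (1 : ℂ) K
    rw [one_smul] at h
    exact ⟨_, h⟩
  exact hn.map_exp (compositeHom x hx)

/-! ### Degree counting: only the top monomial survives -/

omit [LinearOrder J] [Fintype J] [Fintype S] in
/-- If every `x_i` has degree `N`, then `φ(θ_T)` has degree `N|T|`. [cite: Berezin1966, Ch. I §3 (3.3)] -/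
theorem compositeHom_grassmannBasis_mem [Fintype S] {N : ℕ} (hdeg : ∀ i, x i ∈ ⋀[ℂ]^N (J → ℂ))
    (T : Finset (S ⊕ₗ S)) :
    compositeHom x hx (grassmannBasis ℂ (S ⊕ₗ S) T) ∈ ⋀[ℂ]^(N * T.card) (J → ℂ) := by
  rw [grassmannBasis_eq_prod_map_gen, map_list_prod, List.map_map]
  have hmem : ∀ a ∈ (T.sort (· ≤ ·)).map (⇑(compositeHom x hx) ∘ gen ℂ), a ∈ ⋀[ℂ]^N (J → ℂ) := by
    intro a ha
    obtain ⟨i, _, rfl⟩ := List.mem_map.1 ha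
    rw [Function.comp_apply, compositeHom_gen]
    exact hdeg i
  have hl := list_prod_mem_exteriorPower (d := N) _ hmem
  rw [List.length_map, Finset.length_sort] at hl
  exact hl

/-- The Berezin integral is the `univ`-coordinate. [cite: Berezin1966, Ch. I §3 (3.4)–(3.5)] -/
theorem berezin_eq_coord_univ {κ : Type*} [LinearOrder κ] [Fintype κ] (a : GrassmannAlgebra ℂ κ) :
    berezin ℂ κ a = coord Finset.univ a := rfl

/-- **Transport of the Berezin integral along `φ`** (degree counting): if every `x_i` has degree
`N ≥ 1`, `P` has degree `d` and `d + N·|S ⊕ S| = |J|`, then for every `ω ∈ Λ[c̄, c]`,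
`∫_J P·φ(ω) = (∫_{S⊕S} ω) · ∫_J P·φ(θ_univ)` — lower monomials of `ω` map to elements of too low a
degree (Berezin (3.4): they integrate to zero). [cite: Berezin1966, Ch. I §3 (3.3)–(3.5)] -/
theorem berezin_mul_compositeHom {N d : ℕ} (hdeg : ∀ i, x i ∈ ⋀[ℂ]^N (J → ℂ)) (hN : 0 < N)
    {P : GrassmannAlgebra ℂ J} (hP : P ∈ ⋀[ℂ]^d (J → ℂ)) (hcard : d + N * Fintype.card (S ⊕ₗ S) = Fintype.card J)
    (ω : GrassmannAlgebra ℂ (S ⊕ₗ S)) :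
    berezin ℂ J (P * compositeHom x hx ω) =
      berezin ℂ (S ⊕ₗ S) ω * berezin ℂ J (P * compositeHom x hx (grassmannBasis ℂ (S ⊕ₗ S) Finset.univ)) := by
  conv_lhs => rw [eq_sum_coord_smul ω]
  rw [map_sum, Finset.mul_sum, map_sum]
  simp only [map_smul, mul_smul_comm, smul_eq_mul]
  rw [Finset.sum_eq_single Finset.univ, berezin_eq_coord_univ ω]
  · intro T _ hT
    have hlt : T.card < Fintype.card (S ⊕ₗ S) := by
      rw [← Finset.card_univ]
      exact Finset.card_lt_card (Finset.ssubset_univ_iff.2 hT)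
    have hmem : P * compositeHom x hx (grassmannBasis ℂ (S ⊕ₗ S) T) ∈ ⋀[ℂ]^(d + N * T.card) (J → ℂ) :=
      mul_mem_exteriorPower hP (compositeHom_grassmannBasis_mem hx hdeg T)
    have hne : d + N * T.card ≠ Fintype.card J := by
      rw [← hcard]
      have := Nat.mul_lt_mul_left hN |>.2 hlt
      omega
    rw [berezin_eq_zero_of_mem_exteriorPower ℂ hne hmem, mul_zero]
  · intro h; exact absurd (Finset.mem_univ _) h

/-- **The composite Gaussian Berezin integral**: for a pairwise anticommuting family `x` of degree-`N`
elements (`N ≥ 1`) and `P` of complementary degree,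
`∫_J P · exp(∑_{u,v} K_{uv} x_{inl u} x_{inr v}) = (-1)^{k(k-1)/2} det K · ∫_J P·φ(θ_univ)`, `k = |S|`
— Berezin's Gaussian theorem (Thm 3.1; Montvay–Münster (4.22)) transported along `φ`. [cite: Berezin1966, Ch. I §3 Thm 3.1] [cite: MontvayMunster1994, §4.1.3 (4.22)] -/
theorem berezin_mul_grassmannExp_composite {N d : ℕ} (hdeg : ∀ i, x i ∈ ⋀[ℂ]^N (J → ℂ)) (hN : 0 < N)
    {P : GrassmannAlgebra ℂ J} (hP : P ∈ ⋀[ℂ]^d (J → ℂ)) (hcard : d + N * Fintype.card (S ⊕ₗ S) = Fintype.card J)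
    (K : Matrix S S ℂ) :
    berezin ℂ J (P * grassmannExp (∑ u, ∑ v, K u v • (x (toLex (Sum.inl u)) * x (toLex (Sum.inr v))))) =
      (-1 : ℂ) ^ (Fintype.card S * (Fintype.card S - 1) / 2) * K.det *
        berezin ℂ J (P * compositeHom x hx (grassmannBasis ℂ (S ⊕ₗ S) Finset.univ)) := by
  have hG : berezin ℂ (S ⊕ₗ S) (grassmannExp (quadratic ℂ K)) =
      (-1 : ℂ) ^ (Fintype.card S * (Fintype.card S - 1) / 2) * K.det :=
    berezin_grassmannExp_quadratic_holds ℂ K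
  rw [← compositeHom_quadratic hx, ← compositeHom_grassmannExp_quadratic hx, berezin_mul_compositeHom hx hdeg hN hP hcard, hG]

/-! ### The image of the top monomial -/

/-- The increasing enumeration of `S ⊕ₗ S` induced by that of `S`: all `inl` first, then all `inr`. [cite: Berezin1966, Ch. I §3 (3.3)] -/
theorem sort_univ_sumLex_eq_ofFn {k : ℕ} (c : Fin k ≃o S) :
    (Finset.univ : Finset (S ⊕ₗ S)).sort (· ≤ ·) =
      List.ofFn (fun p : Fin (k + k) => toLex (Sum.map c c (finSumFinEquiv.symm p))) := by
  set e : Fin (k + k) → S ⊕ₗ S := fun p => toLex (Sum.map c c (finSumFinEquiv.symm p)) with he_def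
  have he : StrictMono e := strictMono_toLex_sumMap_finSumFinEquiv_symm c.strictMono
  have hk : (Finset.univ : Finset (S ⊕ₗ S)).card = k + k := by
    rw [Finset.card_univ, Fintype.card_lex, Fintype.card_sum, ← Fintype.card_fin k, Fintype.card_congr c.toEquiv]
  have he' : e = ⇑(Finset.univ.orderEmbOfFin hk) :=
    Finset.orderEmbOfFin_unique hk (fun _ => Finset.mem_univ _) he
  rw [← Finset.listMap_orderEmbOfFin_finRange _ hk, ← he', ← List.ofFn_eq_map]

omit [LinearOrder J] [Fintype J] in
/-- **The image of the top monomial is the ordered product `(∏_u x_{inl u})(∏_u x_{inr u})`** (both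
products in the increasing order of `S`). [cite: Berezin1966, Ch. I §3 (3.3)] -/
theorem compositeHom_grassmannBasis_univ {k : ℕ} (c : Fin k ≃o S) :
    compositeHom x hx (grassmannBasis ℂ (S ⊕ₗ S) Finset.univ) =
      (List.ofFn fun q : Fin k => x (toLex (Sum.inl (c q)))).prod *
        (List.ofFn fun q : Fin k => x (toLex (Sum.inr (c q)))).prod := by
  rw [grassmannBasis_eq_prod_map_gen, sort_univ_sumLex_eq_ofFn c, map_list_prod, List.map_ofFn, List.map_ofFn,
    ← List.prod_append, ← List.ofFn_fin_append]
  refine congrArg (fun f : Fin (k + k) → GrassmannAlgebra ℂ J => (List.ofFn f).prod) (funext fun p => ?_)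
  refine Fin.addCases (fun q => ?_) (fun q => ?_) p
  · dsimp only [Function.comp_apply]
    rw [Fin.append_left, finSumFinEquiv_symm_apply_castAdd, Sum.map_inl, compositeHom_gen]
  · dsimp only [Function.comp_apply]
    rw [Fin.append_right, finSumFinEquiv_symm_apply_natAdd, Sum.map_inr, compositeHom_gen]

end CompositeGaussian

end GrassmannAlgebra

end Literature.MathematicalPhysics.QuantumLattice
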